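import Literature.AlgebraicGeometry.Motives.ProjectiveBundleOfQuotientRestrict
import Literature.AlgebraicGeometry.Motives.GrassmannianSplitSurjectionSections
import Literature.AlgebraicGeometry.Motives.GrassmannianSplitSurjectionKernel
import HarnessLib

/-!
# Local triviality of `P(G) → X`: over an open where `𝒪^J ↠ G` splits, `U × Gr₁(M')` represents the `U`-points of `P(G)`

Topic `AlgebraicGeometry/Motives`; namespace `Literature.AlgebraicGeometry.Motives.Grassmannian.ProjBundle`. DEFINITIONS with bodies
(`resTop`, `prodRepresentableBy`, `trivialisationIso`) and theorems; no instance, no notation, no named fact, no `sorry`.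

[Hartshorne1977, II §7 Prop. 7.11]: `P(ℰ) → X` is Zariski-locally `U × ℙʳ → U`; [GortzWedhorn2020, (13.8)]: `ℙ(ℰ)(T)` = line-bundle
quotients of `f^*ℰ`. For the tree's incidence model `P(G) = V(u_φ) ↪ X × Gr₁(M)` of an epimorphism `φ : 𝒪_X^{(J)} ↠ G`
(★ `Motives/ProjectiveBundleOfQuotient`) and an open `U ⊆ X` carrying SPLITTING DATA of `φ|_U` — matrices `S ∈ M_{J'×J}(Γ(X, U))`,
`R ∈ M_{J×J'}(Γ(X, U))` with `S R = 1`, such that `S` kills the coordinates of the relations of `G` (`hS`) and the columns of `1 - R S`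
ARE coordinates of relations over `U` (`hk`); e.g. `S` = the matrix of `φ|_U` in a frame of `G|_U` over an affine `U` — this file
proves that **`U × Gr₁(M')` REPRESENTS the presheaf `liftPoints U`** of ★ `Motives/ProjectiveBundleOfQuotientRestrict`
(`prodRepresentableBy`): a `T`-point `(f', g')` of `U × Gr₁(M')` goes to `(f', S_T⁻¹ g')` (★ `splitPrecompHom`, `S_T` the matrix pulled
back to `Γ(T, ⊤)`), which lies in `P(G)` by the kernel criterion ★ `exists_lift_iff` (the relations die in `S_T⁻¹(·) ⊇ ker S_T`);
conversely a `U`-point `(f', g)` of `P(G)` has `ker S_T|_V ≤ g|_V` on affines (the columns of `1 - R S` are relations,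
★ `ker_matLinMap_le_span_columns`), so `g = S_T⁻¹ g'` for a unique `g'` (★ `exists_eq_splitPrecompHom_iff`). Since `proj⁻¹U` represents the
same presheaf (★ `liftPointsRepresentableBy`), uniqueness of representing objects gives the **local trivialisation**
`trivialisationIso : ↑(proj⁻¹U) ≅ ↑U ⨯ Gr₁(M')` with `trivialisationIso_hom_fst : hom ≫ pr₁ = proj|_U`.

## References
* [Hartshorne1977] R. Hartshorne, *Algebraic Geometry* (1977), II §7 Prop. 7.11, Prop. 7.12.
* [GortzWedhorn2020] U. Görtz, T. Wedhorn, *Algebraic Geometry I*, 2nd ed. (2020), (13.8), (8.4) (pp. 213–215), Prop. 8.17 (2), (4.4).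
-/

set_option autoImplicit false

noncomputable section

set_option backward.isDefEq.respectTransparency false

open CategoryTheory CategoryTheory.Limits Opposite TopologicalSpace AlgebraicGeometry TensorProduct Matrix
open Literature.AlgebraicGeometry.Modules

namespace Literature.AlgebraicGeometry.Motives.Grassmannian

namespace ProjBundle

variable {X : Scheme.{0}} (M : Type) [AddCommGroup M] {J : Type} [Fintype J] [DecidableEq J] (b : Module.Basis J ℤ M)
  [(grassmannianSheaf M 1).obj.IsRepresentable] {G : X.Modules} (φ : freeModule X J ⟶ G)
  (M' : Type) [AddCommGroup M'] {J' : Type} [Fintype J'] [DecidableEq J'] (b' : Module.Basis J' ℤ M')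
  [(grassmannianSheaf M' 1).obj.IsRepresentable] (U : X.Opens)

/-! ## §1 Pulling sections over `U` back to a scheme over `U` -/

omit [Fintype J] [DecidableEq J] in
/-- A morphism into the open subscheme `↑U` lands in `U`: `⊤ ≤ (f' ≫ (U ↪ X))⁻¹ U`. [cite: GortzWedhorn2020, (13.8)] -/
theorem top_le_preimage {T : Scheme.{0}} (f' : T ⟶ (U : Scheme.{0})) : (⊤ : T.Opens) ≤ (f' ≫ U.ι) ⁻¹ᵁ U := by
  rw [Scheme.Hom.comp_preimage, Scheme.Opens.ι_preimage_self]
  exact le_rfl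

/-- **The ring map `Γ(X, U) → Γ(T, ⊤)` of a `U`-scheme `f' : T ⟶ U`** (Mathlib `Scheme.Hom.appLE`). [cite: GortzWedhorn2020, (13.8)] -/
def resTop {T : Scheme.{0}} (f' : T ⟶ (U : Scheme.{0})) : Γ(X, U) →+* Γ(T, ⊤) :=
  ((f' ≫ U.ι).appLE U ⊤ (top_le_preimage U f')).hom

omit [Fintype J] [DecidableEq J] in
/-- Transitivity: `resTop (h ≫ f') = h♯ ∘ resTop f'`. [cite: GortzWedhorn2020, (13.8)] -/
theorem resTop_comp {T T' : Scheme.{0}} (h : T' ⟶ T) (f' : T ⟶ (U : Scheme.{0})) :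
    resTop U (h ≫ f') = h.appTop.hom.comp (resTop U f') := by
  have e := Scheme.Hom.appLE_comp_appLE h (f' ≫ U.ι) U ⊤ ⊤ (top_le_preimage U f') le_top
  have e' : h.appLE ⊤ ⊤ le_top = h.appTop := Scheme.Hom.appLE_eq_app h
  rw [e'] at e
  unfold resTop
  rw [← CommRingCat.hom_comp, e]
  simp only [Category.assoc]

omit [Fintype J] [DecidableEq J] in
/-- Restricting `resTop f'` further to an open `V ⊆ T` is `appLE` of `f' ≫ (U ↪ X)`. [cite: GortzWedhorn2020, (13.8)] -/
theorem map_comp_resTop {T : Scheme.{0}} (f' : T ⟶ (U : Scheme.{0})) (V : T.Opens) :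
    (T.presheaf.map (homOfLE (le_top : V ≤ ⊤)).op).hom.comp (resTop U f') =
      ((f' ≫ U.ι).appLE U V (le_top.trans (top_le_preimage U f'))).hom := by
  unfold resTop
  rw [← CommRingCat.hom_comp, Scheme.Hom.appLE_map]

omit [Fintype J] [DecidableEq J] in
/-- `appLE` along `W ⊓ U ≤ W`: `f.appLE W V = f.appLE (W ⊓ U) V ∘ res`, for `V ≤ f⁻¹(W ⊓ U)`. [cite: GortzWedhorn2020, (13.8)] -/
theorem appLE_eq_appLE_inf {T : Scheme.{0}} (f : T ⟶ X) (W : X.Opens) (V : T.Opens) (h : V ≤ f ⁻¹ᵁ (W ⊓ U)) (a : Γ(X, W)) :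
    f.appLE W V (h.trans (f.preimage_mono inf_le_left)) a =
      f.appLE (W ⊓ U) V h (X.presheaf.map (homOfLE inf_le_left).op a) := by
  rw [← CommRingCat.comp_apply, Scheme.Hom.map_appLE]

/-! ## §2 `U × Gr₁(M')` represents `liftPoints U` -/

section Represent

variable [Epi φ] (hG : IsFiniteLocallyFree G)
  (S : Matrix J' J Γ(X, U)) (R : Matrix J J' Γ(X, U)) (hSR : S * R = 1)
  (hS : ∀ (W : X.Opens) (s : Γ(kernel φ, W)) (i : J'),
    ∑ j, X.presheaf.map (homOfLE (inf_le_right : W ⊓ U ≤ U)).op (S i j) *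
      X.presheaf.map (homOfLE (inf_le_left : W ⊓ U ≤ W)).op (coord (freeModuleFrame X J W) (𝟙 W) ((kernel.ι φ).app W s) j) = 0)
  (k : J → Γ(kernel φ, U))
  (hk : ∀ j l, coord (freeModuleFrame X J U) (𝟙 U) ((kernel.ι φ).app U (k l)) j = ((1 : Matrix J J Γ(X, U)) - R * S) j l)

omit [DecidableEq J] in
include hG in
/-- The kernel criterion of ★ `exists_lift_iff` for a pair `(f, g)` (rewriting `prod.lift f g ≫ prᵢ`).
[cite: GortzWedhorn2020, (13.8)] -/
theorem exists_lift_iff' {T : Scheme.{0}} (f : T ⟶ X) (g : T ⟶ grassmannianScheme M 1) :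
    (∃ t' : T ⟶ total M b φ, t' ≫ totalι M b φ = prod.lift f g) ↔
      ∀ (W : X.Opens) (s : Γ(kernel φ, W)) (V : T.Opens) (hV : IsAffineOpen V) (hVW : V ≤ f ⁻¹ᵁ W),
        (∑ j, f.appLE W V hVW (coord (freeModuleFrame X J W) (𝟙 W) ((kernel.ι φ).app W s) j) ⊗ₜ[ℤ] b j) ∈
          (evalAffine hV (pointsEquiv M 1 T g)).toSubmodule := by
  have h := exists_lift_iff M b φ (prod.lift f g) hG
  simp only [prod.lift_fst, prod.lift_snd] at h
  exact h

omit [DecidableEq J] in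
include hG hS in
/-- **The point `(f', S⁻¹g')` lies in `P(G)`**: the pulled-back relations of `G` die in `S_T⁻¹(g')` because `S` kills their
coordinates (`hS`) and `ker S_T|_V ≤ S_T⁻¹(·)|_V`. [cite: GortzWedhorn2020, (13.8)] [cite: Hartshorne1977, II §7 Prop. 7.12] -/
theorem exists_lift_splitPrecompHom {T : Scheme.{0}} (f' : T ⟶ (U : Scheme.{0})) (g' : T ⟶ grassmannianScheme M' 1) :
    ∃ t' : T ⟶ total M b φ, t' ≫ totalι M b φ =
      prod.lift (f' ≫ U.ι) (splitPrecompHom b b' (S.map (resTop U f')) (R.map (resTop U f'))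
        (map_mul_eq_one_of_mul_eq_one _ hSR) g') := by
  rw [exists_lift_iff' M b φ hG]
  intro W s V hV hVW
  rw [evalAffine_pointsEquiv_splitPrecompHom]
  refine ker_matLinMap_le_splitPrecomp b b' _ _ _ _ ((sum_tmul_mem_ker_matLinMap_iff b b' _ _).mpr ?_)
  funext i
  rw [Pi.zero_apply, Matrix.mulVec, dotProduct]
  -- compute in `Γ(T, V)` through `Γ(X, W ⊓ U)`
  have hVWU : V ≤ (f' ≫ U.ι) ⁻¹ᵁ (W ⊓ U) := le_inf hVW (le_top.trans (top_le_preimage U f'))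
  have h0 := congrArg ((f' ≫ U.ι).appLE (W ⊓ U) V hVWU) (hS W s i)
  rw [map_zero, map_sum] at h0
  rw [← h0]
  refine Finset.sum_congr rfl fun j _ => ?_
  rw [map_mul, appLE_eq_appLE_inf U (f' ≫ U.ι) W V hVWU]
  congr 1
  -- the `(i, j)` entry of `S` restricted to `V`
  change ((T.presheaf.map (homOfLE (le_top : V ≤ ⊤)).op).hom.comp (resTop U f')) (S i j) = _
  rw [map_comp_resTop, ← CommRingCat.comp_apply, Scheme.Hom.map_appLE]

omit [DecidableEq J'] [(grassmannianSheaf M' 1).obj.IsRepresentable] in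
include hG hk in
/-- **A `U`-point `(f', g)` of `P(G)` has `ker S_T|_V ≤ g|_V` on every affine open `V`**: the kernel is spanned by the columns of
`1 - R_T S_T` (★ `ker_matLinMap_le_span_columns`), which are the pulled-back coordinates of the relations `k_l` (`hk`), and those die
in `g` by ★ `exists_lift_iff`. [cite: GortzWedhorn2020, (13.8)] [cite: Hartshorne1977, II §7 Prop. 7.12] -/
theorem ker_le_evalAffine_of_lift {T : Scheme.{0}} (f' : T ⟶ (U : Scheme.{0})) (g : T ⟶ grassmannianScheme M 1)
    (hlift : ∃ t' : T ⟶ total M b φ, t' ≫ totalι M b φ = prod.lift (f' ≫ U.ι) g) (V : T.Opens) (hV : IsAffineOpen V) :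
    LinearMap.ker (matLinMap b b' (matRestrict V (S.map (resTop U f')))) ≤ (evalAffine hV (pointsEquiv M 1 T g)).toSubmodule := by
  refine (ker_matLinMap_le_span_columns b b' _ (matRestrict V (R.map (resTop U f')))).trans (Submodule.span_le.mpr ?_)
  rintro _ ⟨l, rfl⟩
  have hVU : V ≤ (f' ≫ U.ι) ⁻¹ᵁ U := le_top.trans (top_le_preimage U f')
  have h := (exists_lift_iff' M b φ hG (f' ≫ U.ι) g).mp hlift U (k l) V hV hVU
  have hρ : ∀ a : Γ(X, U), ((f' ≫ U.ι).appLE U V hVU) a =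
      (T.presheaf.map (homOfLE (le_top : V ≤ ⊤)).op).hom (resTop U f' a) := fun a => by
    rw [← RingHom.comp_apply, map_comp_resTop]
  have hent : ∀ j, ((1 : Matrix J J Γ(T, V)) - matRestrict V (R.map (resTop U f')) * matRestrict V (S.map (resTop U f'))) j l =
      ((f' ≫ U.ι).appLE U V hVU) (coord (freeModuleFrame X J U) (𝟙 U) ((kernel.ι φ).app U (k l)) j) := fun j => by
    rw [hk, Matrix.sub_apply, Matrix.sub_apply, map_sub, Matrix.mul_apply, Matrix.mul_apply, map_sum, Matrix.one_apply,
      Matrix.one_apply]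
    congr 1
    · split_ifs <;> simp
    · refine Finset.sum_congr rfl fun i _ => ?_
      rw [map_mul, hρ, hρ]
      rfl
  simp only [hent]
  exact h

omit [DecidableEq J] in
/-- `splitPrecompHom` only depends on the matrices. [cite: GortzWedhorn2020, Prop. 8.17 (2)] -/
theorem splitPrecompHom_congr {T : Scheme.{0}} {S₁ S₂ : Matrix J' J Γ(T, ⊤)} {R₁ R₂ : Matrix J J' Γ(T, ⊤)} (hS₁₂ : S₁ = S₂)
    (hR₁₂ : R₁ = R₂) (h₁ : S₁ * R₁ = 1) (h₂ : S₂ * R₂ = 1) (g' : T ⟶ grassmannianScheme M' 1) :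
    splitPrecompHom b b' S₁ R₁ h₁ g' = splitPrecompHom b b' S₂ R₂ h₂ g' := by
  subst hS₁₂; subst hR₁₂; rfl

include hG hk in
/-- The `Gr₁(M')`-component of a `U`-point of `P(G)`: a (unique) `g'` with `S_T⁻¹ g' = g`. [cite: GortzWedhorn2020, (13.8)] -/
theorem exists_splitPrecompHom_eq {T : Scheme.{0}} (f' : T ⟶ (U : Scheme.{0})) (g : T ⟶ grassmannianScheme M 1)
    (hlift : ∃ t' : T ⟶ total M b φ, t' ≫ totalι M b φ = prod.lift (f' ≫ U.ι) g) :
    ∃ g' : T ⟶ grassmannianScheme M' 1,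
      splitPrecompHom b b' (S.map (resTop U f')) (R.map (resTop U f')) (map_mul_eq_one_of_mul_eq_one _ hSR) g' = g :=
  (exists_eq_splitPrecompHom_iff b b' _ _ _ g).mpr (ker_le_evalAffine_of_lift M b φ M' b' U hG S R k hk f' g hlift)

include hG hS hk in
/-- **`U × Gr₁(M')` REPRESENTS `liftPoints U`** when `φ|_U` splits: `(f', g') ↦ (f', S_T⁻¹ g')`, inverse by the unique `g'` with
`S_T⁻¹ g' = g` (★ `splitPrecompHom_injective`, `exists_eq_splitPrecompHom_iff`), natural by ★ `comp_splitPrecompHom`.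
[cite: GortzWedhorn2020, (13.8)] [cite: Hartshorne1977, II §7 Prop. 7.11] -/
def prodRepresentableBy : (liftPoints M b φ U).RepresentableBy ((U : Scheme.{0}) ⨯ grassmannianScheme M' 1) where
  homEquiv {T} :=
    { toFun := fun y => ⟨(y ≫ prod.fst, splitPrecompHom b b' (S.map (resTop U (y ≫ prod.fst))) (R.map (resTop U (y ≫ prod.fst)))
          (map_mul_eq_one_of_mul_eq_one _ hSR) (y ≫ prod.snd)),
        exists_lift_splitPrecompHom M b φ M' b' U hG S R hSR hS (y ≫ prod.fst) (y ≫ prod.snd)⟩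
      invFun := fun q => prod.lift q.1.1 (exists_splitPrecompHom_eq M b φ M' b' U hG S R hSR k hk q.1.1 q.1.2 q.2).choose
      left_inv := fun y => by
        apply Limits.prod.hom_ext
        · rw [prod.lift_fst]
        · rw [prod.lift_snd]
          exact splitPrecompHom_injective b b' _ _ _
            (exists_splitPrecompHom_eq M b φ M' b' U hG S R hSR k hk (y ≫ prod.fst) _
              (exists_lift_splitPrecompHom M b φ M' b' U hG S R hSR hS (y ≫ prod.fst) (y ≫ prod.snd))).choose_spec
      right_inv := fun q => by
        obtain ⟨⟨f', g⟩, hq⟩ := q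
        apply Subtype.ext
        apply Prod.ext
        · exact prod.lift_fst _ _
        · change splitPrecompHom b b' (S.map (resTop U (prod.lift f' _ ≫ prod.fst)))
            (R.map (resTop U (prod.lift f' _ ≫ prod.fst))) _ (prod.lift f' _ ≫ prod.snd) = g
          rw [splitPrecompHom_congr M b M' b' (by rw [prod.lift_fst]) (by rw [prod.lift_fst]) _
            (map_mul_eq_one_of_mul_eq_one _ hSR), prod.lift_snd]
          exact (exists_splitPrecompHom_eq M b φ M' b' U hG S R hSR k hk f' g hq).choose_spec }
  homEquiv_comp {T T'} h y := by
    apply Subtype.ext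
    apply Prod.ext
    · exact Category.assoc _ _ _
    · change splitPrecompHom b b' (S.map (resTop U ((h ≫ y) ≫ prod.fst))) (R.map (resTop U ((h ≫ y) ≫ prod.fst))) _
          ((h ≫ y) ≫ prod.snd) =
        h ≫ splitPrecompHom b b' (S.map (resTop U (y ≫ prod.fst))) (R.map (resTop U (y ≫ prod.fst))) _ (y ≫ prod.snd)
      rw [comp_splitPrecompHom]
      have hS' : S.map (resTop U ((h ≫ y) ≫ prod.fst)) = (S.map (resTop U (y ≫ prod.fst))).map h.appTop.hom := by
        rw [Matrix.map_map, Category.assoc, resTop_comp]; rfl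
      have hR' : R.map (resTop U ((h ≫ y) ≫ prod.fst)) = (R.map (resTop U (y ≫ prod.fst))).map h.appTop.hom := by
        rw [Matrix.map_map, Category.assoc, resTop_comp]; rfl
      refine (splitPrecompHom_congr M b M' b' hS' hR' _
        (map_mul_eq_one_of_mul_eq_one _ (map_mul_eq_one_of_mul_eq_one _ hSR)) _).trans ?_
      rw [Category.assoc]

/-- **THE LOCAL TRIVIALISATION `proj⁻¹U ≅ U × Gr₁(M')`** (uniqueness of representing objects for `liftPoints U`, Mathlib
`Functor.RepresentableBy.uniqueUpToIso`, ★ `liftPointsRepresentableBy`). [cite: Hartshorne1977, II §7 Prop. 7.11]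
[cite: GortzWedhorn2020, (13.8)] -/
def trivialisationIso : (((proj M b φ) ⁻¹ᵁ U : (total M b φ).Opens) : Scheme.{0}) ≅ (U : Scheme.{0}) ⨯ grassmannianScheme M' 1 :=
  (liftPointsRepresentableBy M b φ U).uniqueUpToIso (prodRepresentableBy M b φ M' b' U hG S R hSR hS k hk)

/-- The trivialisation commutes with the projections to `U`: `hom ≫ pr₁ = proj|_U`. [cite: Hartshorne1977, II §7 Prop. 7.11] -/
theorem trivialisationIso_hom_fst :
    (trivialisationIso M b φ M' b' U hG S R hSR hS k hk).hom ≫ prod.fst = (proj M b φ) ∣_ U := by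
  change ((prodRepresentableBy M b φ M' b' U hG S R hSR hS k hk).homEquiv.symm
    ((liftPointsRepresentableBy M b φ U).homEquiv (𝟙 _))) ≫ prod.fst = _
  change prod.lift _ _ ≫ prod.fst = _
  rw [prod.lift_fst]
  exact Category.id_comp _

end Represent



end ProjBundle

end Literature.AlgebraicGeometry.Motives.Grassmannian

end
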